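import Literature.AnabelianGeometry.EtaleTheta.ThetaCoversTwistedModelDefs
import HarnessLib

/-!
# The TWISTED NV-L2 model of `ThetaCovers.TemperedCoverData` ([EtTh] §2), part 2: the orbicurve `C̲̲` of type
# `(1, l-torsΘ)±` (Def. 2.3) in the model — the data `(Π_C̲, ι̲, E = Im(s_ι), S)` of Prop. 2.2 and `Π_C̲̲ := (S·E)·⟨ι̲⟩`

S. Mochizuki, *The étale theta function …*, Publ. RIMS **45** (2009) [MochizukiEtTh2009], §2, Def. 2.1 – Def. 2.3
(PDF pp.36–38).  abc-iut cell, block F (fact-proving wave), seat abc-iut-f-142 (FACT-LIST row F-0601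
`TemperedCoverData.Cor29_preserved`).  CONSISTENCY WITNESS / TOY (continuation of `ThetaCoversTwistedModelDefs.lean`,
same honest labels); PROOF-ONLY (0 definitions: the data `Π_C̲`, `E`, `ι̲`, `Π_C̲̲` are the `def`s `HpB`, `EB`, `iotaB`,
`PiCuuB` of the defs file).  The proofs are abc-iut-w5-d118's (`Discharge/Sec2TemperedCoverDataModelTheta.lean`)
VERBATIM, read through the twisted model's coordinate `Φ : Π_C = B × Ẑ → (ℤ/l × ℤ/l) ⋊ D_l` (the twist by the
second copy `M` of the `(b, c)`-plane is invisible to `Φ` and `Ψ`); the only new input is `D_x ⊆ Δ̄_Θ-preimage`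
(`DxB_le_barThetaB`) for the two `D_x`-conditions of Def. 2.1 / Prop. 2.2 (ii).

In the model: `Π_C̲ := Φ⁻¹(heisPiCu)` (the toy's `(ℤ/l × ℤ/l) ⋊ {1, s}`), `Π_X̲ = Π_C̲ ∩ Π_X = Φ⁻¹{rotation index 0}`,
`ι̲ := ((s, 1), 1)`, `E := Π_X̲ ∩ Ker Ψ`, the splitting `S := Ker(Δ_X ↠ Δ̄_X)` (`G_K = 1`), and `Π_C̲̲ := (S · E) · ⟨ι̲⟩`
(Def. 2.3) — PROVED to be of type `(1, l-torsΘ)±` (`isTypeLTorsThetaPm_PiCuuB`) and open.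
no side taken on [IUTchIII] Cor 3.12; typed ≠ proved. [cite: MochizukiEtTh2009, Def 2.3 p.38]
-/

noncomputable section

namespace Literature.AnabelianGeometry.EtaleTheta

namespace ThetaCovers

namespace TwistedModel

open Multiplicative HeisenbergWitness Literature.AnabelianGeometry.SemiGraphs
  Literature.AnabelianGeometry.EtaleTheta.SettingModel TemperedModel

variable (l : ℕ) [NeZero l]

/-! ## 1. Coordinates of `ι̲` -/

omit [NeZero l] in
/-- `Φ ι̲ = s`. (toy bookkeeping) [cite: MochizukiEtTh2009, Prop 2.2 p.36] -/
@[simp] theorem PhiB_iotaB : PhiB l (iotaB l) = SemidirectProduct.inr (DihedralGroup.sr 0) := rfl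

/-- `Ψ ι̲ = 1`. (toy bookkeeping) [cite: MochizukiEtTh2009, Prop 2.2 p.36] -/
@[simp] theorem PsiB_iotaB : PsiB l (iotaB l) = 1 := by
  have h : PsiB l (iotaB l) = piL l 1 := rfl
  rw [h, map_one]

omit [NeZero l] in
/-- `ι̲ ∉ Π_X` (`s` is a reflection). (toy bookkeeping) [cite: MochizukiEtTh2009, Prop 2.2 p.36] -/
theorem iotaB_not_mem_PiXB : iotaB l ∉ PiXB l := by
  intro h
  have h' : PhiB l (iotaB l) ∈ heisPiX l := h
  rw [PhiB_iotaB] at h'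
  obtain ⟨i, hi⟩ := (mem_heisPiX l).mp h'
  cases hi

omit [NeZero l] in
/-- `s² = 1` in the toy. (toy bookkeeping) [cite: MochizukiEtTh2009, Prop 2.2 (iii) p.37] -/
theorem heis_s_mul_s : (SemidirectProduct.inr (DihedralGroup.sr 0) : heisPiC l) *
    SemidirectProduct.inr (DihedralGroup.sr 0) = 1 := by
  rw [← map_mul, DihedralGroup.sr_mul_sr, sub_self, ← DihedralGroup.one_def, map_one]

omit [NeZero l] in
/-- `(ι̲^tp)² = 1` in `Π^tp_C`. (toy bookkeeping) [cite: MochizukiEtTh2009, Prop 2.2 (iii) p.37] -/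
theorem iotaG_mul_self : iotaG l * iotaG l = 1 := by
  refine Prod.ext (Prod.ext ?_ (mul_one _)) (mul_one _)
  change SemidirectProduct.inr (SemidirectProduct.inr (DihedralGroup.sr 0)) *
    SemidirectProduct.inr (SemidirectProduct.inr (DihedralGroup.sr 0)) = (1 : TH l)
  rw [← map_mul, heis_s_mul_s, map_one]

omit [NeZero l] in
/-- `ι̲² = 1`. (toy bookkeeping) [cite: MochizukiEtTh2009, Prop 2.2 (iii) p.37] -/
theorem iotaB_mul_self : iotaB l * iotaB l = 1 := by
  rw [← toHatB_iotaG, ← map_mul, iotaG_mul_self, map_one]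

/-! ## 2. `Π_X̲`, `E`, `Π_C̲̲` -/

omit [NeZero l] in
/-- Membership in `Π_X̲ = Π_C̲ ∩ Π_X`: the `D_l`-component of `Φ` is trivial. (toy bookkeeping)
[cite: MochizukiEtTh2009, Def 2.1 p.36] -/
theorem mem_HpB_inf_iff (x : PiCB l) : x ∈ HpB l ⊓ PiXB l ↔ (PhiB l x).right = 1 :=
  mem_heisPiCu_inf l (x := PhiB l x)

omit [NeZero l] in
/-- `Π_C̲ ∩ Π_X = Φ⁻¹(Π_X̲(toy))`. (toy bookkeeping) [cite: MochizukiEtTh2009, Def 2.1 p.36] -/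
theorem HpB_inf_eq : HpB l ⊓ PiXB l = (heisPiCu l ⊓ heisPiX l).comap (PhiB l) :=
  (Subgroup.comap_inf _ _ _).symm

omit [NeZero l] in
/-- `Δ̄_Θ-preimage ⊆ Π_X̲`. (toy bookkeeping) [cite: MochizukiEtTh2009, Def 2.1 p.36] -/
theorem barThetaB_le_HpB_inf : barThetaB l ≤ HpB l ⊓ PiXB l := by
  intro x hx
  exact (mem_HpB_inf_iff l x).mpr ((mem_heisTheta l).mp hx).1

omit [NeZero l] in
/-- `D_x ⊆ Π_X̲` (the NEW input: `D_x ⊆ Δ̄_Θ-preimage`). (toy bookkeeping) [cite: MochizukiEtTh2009, Def 2.1 p.36] -/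
theorem DxB_le_HpB_inf : DxB l ≤ HpB l ⊓ PiXB l := (DxB_le_barThetaB l).trans (barThetaB_le_HpB_inf l)

/-- `E` is open. (toy bookkeeping) [cite: MochizukiEtTh2009, Prop 2.2 (i) p.37] -/
theorem isOpen_EB : IsOpen (EB l : Set (PiCB l)) := by
  rw [EB, HpB_inf_eq]
  change IsOpen (((PhiB l) ⁻¹' ((heisPiCu l ⊓ heisPiX l : Subgroup (heisPiC l)) : Set (heisPiC l))) ∩
    ((PsiB l).ker : Set (PiCB l)))
  exact (isOpen_preimage_PhiB l _).inter (isOpen_ker_PsiB l)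

/-- `Π_C̲̲` is open (it contains the open subgroup `E`). (toy bookkeeping) [cite: MochizukiEtTh2009, Def 2.3 p.38] -/
theorem isOpen_PiCuuB : IsOpen (PiCuuB l : Set (PiCB l)) :=
  Subgroup.isOpen_mono (le_sup_right.trans le_sup_left) (isOpen_EB l)

/-! ## 3. The rotation-index character on `Π_X` and the type `(1, l-tors)±` of `Π_C̲` -/

omit [NeZero l] in
/-- The rotation character of the model, `Π_X → heisPiX → ℤ/l` (`rotChar ∘ Φ`), is onto. (toy bookkeeping)
[cite: MochizukiEtTh2009, Def 2.1 p.36] -/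
theorem rotChar_comp_surjective :
    Function.Surjective ((rotChar l).comp ((PhiB l).subgroupComap (heisPiX l))) := by
  intro y
  obtain ⟨a, rfl⟩ := Multiplicative.ofAdd.surjective y
  obtain ⟨x, hx⟩ := PhiB_surjective l (SemidirectProduct.inr (DihedralGroup.r a))
  have hxX : x ∈ PiXB l := by
    change PhiB l x ∈ heisPiX l
    rw [hx]
    exact (mem_heisPiX l).mpr ⟨a, rfl⟩
  refine ⟨⟨x, hxX⟩, ?_⟩
  change ofAdd (rotIdx l (PhiB l x).right) = ofAdd a
  rw [hx, SemidirectProduct.right_inr, rotIdx_r]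

variable (hl : Odd l)

/-- **`Π_C̲` is of type `(1, l-tors)±`** in the model (Def. 2.1): `Π_X̲ = Π_C̲ ∩ Π_X` is the kernel of the rotation
character `Π_X ↠ ℤ/l`, contains `Δ̄_Θ-preimage ⊇ D_x`, and has index `2` in `Π_C̲` — from the toy's
`isTypeLTorsPm_heisPiCu` through the surjection `Φ`. [cite: MochizukiEtTh2009, Def 2.1 p.36] -/
theorem isTypeLTorsPm_HpB : (coverDataAx l hl).toCoverData.IsTypeLTorsPm (HpB l) := by
  refine ⟨⟨inf_le_right, ⟨(rotChar l).comp ((PhiB l).subgroupComap (heisPiX l)), rotChar_comp_surjective l,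
    fun g => ?_⟩, barThetaB_le_HpB_inf l, ?_, DxB_le_HpB_inf l⟩, ?_⟩
  · -- kernel of the rotation character
    change rotChar l ((PhiB l).subgroupComap (heisPiX l) g) = 1 ↔ (g : PiCB l) ∈ HpB l ⊓ PiXB l
    rw [rotChar_eq_one_iff]
    rfl
  · -- `Π_X̲ · Δ_X = Π_X` (`Δ_X = Π_X`)
    change (HpB l ⊓ PiXB l) ⊔ (PiXB l ⊓ (1 : PiCB l →* PUnit.{1}).ker) = PiXB l
    rw [MonoidHom.ker_one, inf_top_eq]
    exact le_antisymm (sup_le inf_le_right le_rfl) le_sup_right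
  · -- `[Π_C̲ : Π_X̲] = 2`
    change (HpB l ⊓ PiXB l).relIndex (HpB l) = 2
    rw [HpB_inf_eq, HpB, Subgroup.relIndex_comap,
      Subgroup.map_comap_eq_self_of_surjective (PhiB_surjective l)]
    exact (isTypeLTorsPm_heisPiCu l hl).relIndex_two

/-- `ι̲` is an inversion for `Π_C̲` (`ι̲ ∈ Π_C̲ ∩ Δ_C ∖ Π_X`). [cite: MochizukiEtTh2009, Prop 2.2 p.36] -/
theorem isInversion_iotaB : (coverDataAx l hl).toCoverData.IsInversion (HpB l) (iotaB l) := by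
  refine ⟨?_, mem_ker_oneB l _, iotaB_not_mem_PiXB l⟩
  change PhiB l (iotaB l) ∈ heisPiCu l
  rw [PhiB_iotaB]
  exact Or.inr rfl

/-- `E ∩ Δ̄_Θ-preimage = Ker`. (toy bookkeeping) [cite: MochizukiEtTh2009, Prop 2.2 (i) p.37] -/
theorem EB_inf_barThetaB : EB l ⊓ barThetaB l = barKerB l := by
  refine le_antisymm ?_ ?_
  · rintro x ⟨⟨-, hxK⟩, hxT⟩
    exact ⟨hxT, hxK⟩
  · rintro x ⟨hxT, hxK⟩
    exact ⟨⟨barThetaB_le_HpB_inf l hxT, hxK⟩, hxT⟩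

/-- `E · Δ̄_Θ-preimage = Π_X̲` (every `x ∈ Π_X̲` is `(x t⁻¹) · t` with `t ∈ 1 × Ẑ`, `Ψ t = Ψ x`). (toy bookkeeping)
[cite: MochizukiEtTh2009, Prop 2.2 (i) p.37] -/
theorem EB_sup_barThetaB : EB l ⊔ barThetaB l = HpB l ⊓ PiXB l := by
  refine le_antisymm (sup_le inf_le_left (barThetaB_le_HpB_inf l)) fun x hx => ?_
  obtain ⟨z, hz⟩ := PsiB_surjective_right l (PsiB l x)
  have ht : ((1 : TB l), z) ∈ barThetaB l := one_prod_mem_barThetaB l z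
  have hE : x * ((1 : TB l), z)⁻¹ ∈ EB l := by
    refine ⟨Subgroup.mul_mem _ hx (Subgroup.inv_mem _ (barThetaB_le_HpB_inf l ht)), ?_⟩
    show x * ((1 : TB l), z)⁻¹ ∈ (PsiB l).ker
    rw [MonoidHom.mem_ker, map_mul, map_inv, hz, mul_inv_cancel]
  have : x = x * ((1 : TB l), z)⁻¹ * ((1 : TB l), z) := by rw [inv_mul_cancel_right]
  rw [this]
  exact Subgroup.mul_mem _ (Subgroup.mem_sup_left hE) (Subgroup.mem_sup_right ht)

/-- **`E` is the `(−1)`-eigenspace datum `Im(s_ι)`** of Prop. 2.2 (i) for `(Π_X̲, Π_C̲, ι̲)` in the model.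
[cite: MochizukiEtTh2009, Prop 2.2 (i) p.37] -/
theorem isMinusEigen_EB :
    (coverDataAx l hl).toCoverData.IsMinusEigen (HpB l ⊓ PiXB l) (HpB l) (iotaB l) (EB l) := by
  haveI : (PsiB l).ker.Normal := MonoidHom.normal_ker _
  refine ⟨?_, ?_, ?_, EB_inf_barThetaB l, ?_, ?_, ?_, ?_⟩
  · -- `Ker ⊆ E`
    exact fun x hx => ⟨barThetaB_le_HpB_inf l hx.1, hx.2⟩
  · -- `E ⊆ Π_X̲ ∩ Δ_C`
    change EB l ≤ (HpB l ⊓ PiXB l) ⊓ (1 : PiCB l →* PUnit.{1}).ker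
    rw [MonoidHom.ker_one, inf_top_eq]
    exact inf_le_left
  · -- normalised by `Π_X̲`
    intro g hg e he
    exact ⟨Subgroup.mul_mem _ (Subgroup.mul_mem _ hg he.1) (Subgroup.inv_mem _ hg),
      ‹(PsiB l).ker.Normal›.conj_mem e he.2 g⟩
  · -- `E · Δ̄_Θ = Π_X̲ ∩ Δ_C`
    change EB l ⊔ barThetaB l = (HpB l ⊓ PiXB l) ⊓ (1 : PiCB l →* PUnit.{1}).ker
    rw [MonoidHom.ker_one, inf_top_eq]
    exact EB_sup_barThetaB l
  · -- `ι̲` acts by `−1` on `E / Ker`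
    intro e he
    have he1 : (PhiB l e).right = 1 := (mem_HpB_inf_iff l e).mp he.1
    refine ⟨?_, ?_⟩
    · change PhiB l (iotaB l * e * (iotaB l)⁻¹ * e) ∈ heisTheta l
      rw [map_mul, map_mul, map_mul, map_inv, PhiB_iotaB]
      exact heis_s_conj_mul_mem l he1
    · have he2 : PsiB l e = 1 := he.2
      show iotaB l * e * (iotaB l)⁻¹ * e ∈ (PsiB l).ker
      rw [MonoidHom.mem_ker, map_mul, map_mul, map_mul, map_inv, he2, PsiB_iotaB]
      simp
  · -- `ι̲` acts by `+1` on `Δ̄_Θ`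
    intro t ht
    refine ⟨?_, PsiB_comm_mem_ker l _ _⟩
    change PhiB l (iotaB l * t * (iotaB l)⁻¹ * t⁻¹) ∈ heisTheta l
    rw [map_mul, map_mul, map_mul, map_inv, map_inv, PhiB_iotaB,
      heis_inv_theta l hl (c := SemidirectProduct.inr (DihedralGroup.sr 0)) ?_ ht]
    · exact (heisTheta l).one_mem
    · intro h
      obtain ⟨i, hi⟩ := (mem_heisPiX l).mp h
      cases hi
  · -- `ι̲` normalises `E`
    intro e he
    have he1 : (PhiB l e).right = 1 := (mem_HpB_inf_iff l e).mp he.1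
    refine ⟨(mem_HpB_inf_iff l _).mpr ?_, ?_⟩
    · rw [map_mul, map_mul, map_inv, PhiB_iotaB]
      exact heis_s_conj_right l he1
    · have he2 : PsiB l e = 1 := he.2
      show iotaB l * e * (iotaB l)⁻¹ ∈ (PsiB l).ker
      rw [MonoidHom.mem_ker, map_mul, map_mul, map_inv, he2, mul_one, mul_inv_cancel]

/-- `S := Ker(Δ_X ↠ Δ̄_X)` is a splitting of `D̄_x ↠ G_K = 1` in the model (`S ⊆ D_x · Ker` trivially).
[cite: MochizukiEtTh2009, Prop 2.2 (ii) p.37] -/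
theorem isSplitting_barKerB : (coverDataAx l hl).toCoverData.IsSplitting (barKerB l) :=
  ⟨le_rfl, le_sup_right, inf_eq_left.mpr inf_le_left, fun _ => ⟨1, Subsingleton.elim _ _⟩⟩

/-- **`Π_C̲̲` is of type `(1, l-torsΘ)±`** in the twisted model (Def. 2.3 / Prop. 2.2 (iii)): the data
`(Π_C̲, E, S, ι̲)` above with `ι̲² = 1 ∈ Ker`. [cite: MochizukiEtTh2009, Def 2.3 p.38] -/
theorem isTypeLTorsThetaPm_PiCuuB : (coverDataAx l hl).toCoverData.IsTypeLTorsThetaPm (PiCuuB l) :=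
  ⟨HpB l, EB l, barKerB l, iotaB l, isTypeLTorsPm_HpB l hl, isInversion_iotaB l hl,
    by rw [iotaB_mul_self]; exact (barKerB l).one_mem, isMinusEigen_EB l hl, isSplitting_barKerB l hl, rfl⟩

/-! ## 4. `Π_C̲̲ ⊆ Π_C̲` and the elements of `Π_C̲`, `Π_X̲` by their `Φ`-coordinate -/

/-- `Π_C̲̲ ⊆ Π_C̲` in the model (`Ker, E ⊆ Π_X̲ ⊆ Π_C̲`, `ι̲ ∈ Π_C̲`). (toy bookkeeping) [cite: MochizukiEtTh2009, Def 2.3 p.38] -/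
theorem PiCuuB_le_HpB : PiCuuB l ≤ HpB l := by
  have hι : iotaB l ∈ HpB l := by
    change PhiB l (iotaB l) ∈ heisPiCu l
    rw [PhiB_iotaB]
    exact Or.inr rfl
  refine sup_le (sup_le (inf_le_left.trans ((barThetaB_le_HpB_inf l).trans inf_le_left))
    (inf_le_left.trans inf_le_left)) ?_
  rw [Subgroup.zpowers_le]
  exact hι

/-- `Π_C̲ · Δ̄_Θ-preimage`… conversely `Φ⁻¹(heisPiCu) ⊆ Π_C̲̲ · Δ̄_Θ-preimage = Π_C̲` (of Def. 2.1): an element with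
`Φ`-coordinate in `(ℤ/l × ℤ/l) ⋊ {1, s}` is `e · t` or `e · ι̲ · t` with `e ∈ E`, `t ∈ 1 × Ẑ`. (toy bookkeeping)
[cite: MochizukiEtTh2009, Def 2.3 p.38] -/
theorem HpB_le_PiCuuB_sup_barThetaB : HpB l ≤ PiCuuB l ⊔ barThetaB l := by
  intro x hx
  have hx' : PhiB l x ∈ heisPiCu l := hx
  -- reduce to the case of trivial `D_l`-part by multiplying with `ι̲`
  have key : ∀ y : PiCB l, (PhiB l y).right = 1 → y ∈ PiCuuB l ⊔ barThetaB l := by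
    intro y hy
    have hyX : y ∈ HpB l ⊓ PiXB l := (mem_HpB_inf_iff l y).mpr hy
    rw [← EB_sup_barThetaB] at hyX
    have hle : EB l ⊔ barThetaB l ≤ PiCuuB l ⊔ barThetaB l :=
      sup_le_sup_right (le_sup_right.trans le_sup_left) _
    exact hle hyX
  rcases hx' with h1 | h1
  · exact key x h1
  · have hxi : (PhiB l (x * (iotaB l)⁻¹)).right = 1 := by
      rw [map_mul, map_inv, PhiB_iotaB, SemidirectProduct.mul_right, SemidirectProduct.inv_right, h1,
        SemidirectProduct.right_inr, DihedralGroup.inv_sr, DihedralGroup.sr_mul_sr, sub_self, DihedralGroup.one_def]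
    have hι : iotaB l ∈ PiCuuB l ⊔ barThetaB l :=
      Subgroup.mem_sup_left (Subgroup.mem_sup_right (Subgroup.mem_zpowers _))
    have : x = x * (iotaB l)⁻¹ * iotaB l := by rw [inv_mul_cancel_right]
    rw [this]
    exact Subgroup.mul_mem _ (key _ hxi) hι

/-- **`Π_C̲ := Π_C̲̲ · Δ̄_Θ-preimage = Φ⁻¹(heisPiCu)`** in the model. (toy bookkeeping) [cite: MochizukiEtTh2009, Def 2.1 p.36] -/
theorem PiCuuB_sup_barThetaB : PiCuuB l ⊔ barThetaB l = HpB l :=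
  le_antisymm (sup_le (PiCuuB_le_HpB l) ((barThetaB_le_HpB_inf l).trans inf_le_left))
    (HpB_le_PiCuuB_sup_barThetaB l)

/-- **`Π_X̲ := (Π_C̲̲ ∩ Π_X) · Δ̄_Θ-preimage = Φ⁻¹(heisPiCu ∩ heisPiX)`** in the model. (toy bookkeeping)
[cite: MochizukiEtTh2009, Def 2.1 p.36] -/
theorem PiXuuB_sup_barThetaB : (PiCuuB l ⊓ PiXB l) ⊔ barThetaB l = HpB l ⊓ PiXB l := by
  refine le_antisymm (sup_le (inf_le_inf_right _ (PiCuuB_le_HpB l)) (barThetaB_le_HpB_inf l)) ?_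
  rw [← EB_sup_barThetaB]
  refine sup_le_sup_right (le_inf (le_sup_right.trans le_sup_left) ?_) _
  exact inf_le_left.trans inf_le_right

end TwistedModel

end ThetaCovers

end Literature.AnabelianGeometry.EtaleTheta
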